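import Literature.NumberTheory.LFunctions.PsdDyadicCertificate
import HarnessLib

/-!
# Format C, design C∞ (E2 data side): EXACT integer stages — dot products as sums, and the perturbation bounds

Route context: Fourier–Galerkin / Schur-complement certificates of Weil positivity on a window ("format C", C∞ door;
cell memo `run/shared/lean/pub/rh-explicit/rh-explicit-weil-2/gen15/E2-PLAN-v2.md` §6 and the gen16 layout of record,
HOME STATUS 2026-08-25 «weil-2 gen16 STATUS 0/1»; supporting stmt-RiemannHypothesis-0098; seat rh-explicit-weil-2).

The composite evaluator of the certificate door computes its heavy stages (resolved middle columns, middle Gram `T`,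
family matrix `A`, `Hmid·A`, Hankel quadratic part) in EXACT integer arithmetic on the CLAIMED midpoints — GMP-backed
`Int`/`Nat` dot products, measured ≈ 1e-4 s per multiply-add in the kernel, an order of magnitude below outward-rounded
interval products — and carries the enclosure radii ANALYTICALLY.  This file is the generic kit for that:

* `CinfExact.dotZ2 / dotZ3 / absDotN / sumZ / maxAbsZ` — structural recursions (kernel-friendly) and their `Finset.range`
  readings `dotZ2_eq_sum`, `dotZ3_eq_sum`, `absDotN_eq_sum`, `sumZ_eq_sum`, `abs_le_maxAbsZ`;
* the PERTURBATION LEMMAS `abs_sum_mul_sub_le_lin` (exact coefficients), `abs_mul_sub_mul_le` (one product),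
  `abs_sum_mul3_sub_le` (weighted products with exact nonnegative weights), `abs_sum_mul_sub_le` (plain products) —
  `|Σ v x y − Σ v x̄ ȳ| ≤ η_y·Σ v|x̄| + η_x·Σ v|ȳ| + η_x η_y·Σ v` and its relatives;
* `CinfExact.RowsEq` — «the claimed integer table equals the computed rows», with band glue `RowsEq.zero/extend` over
  `CinfExact.allFromTo` (each band its own kernel file; the composite consumes the claims);
* `CinfExact.TabNear / VecNear` — the uniform CLAIMED-TABLE FACT `|f i j − Z[i][j]/2^c| ≤ ρ/2^c` in which every primitive
  object of a rung (kernel block, middle columns, images, Fourier tables, fiber sums, remainders) is delivered by its own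
  level-1 validator file;
* `CinfExact.checkEntryU` + `nearU_of_checkEntryU` — the per-entry final check `|S̄ − mid·2^(E−cu)| + ηZ ≤ ρZ·2^(E−cu)`
  read as the door's `|S − mid·u| ≤ ρZ·u`, `u = 1/2^cu`.

Elementary real inequalities and list bookkeeping; standard axioms; no RH claim.
-/

set_option autoImplicit false
-- `Summit.RiemannHypothesis.RiemannHypothesis.…` is the layout-mandated namespace (summit = problem name).
set_option linter.dupNamespace false

open Finset

namespace Summit.RiemannHypothesis.RiemannHypothesis.Theorems.WeilFormatC

open Literature.NumberTheory.LFunctions (PsdDyadic.getMZ)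

namespace CinfExact

/-! ## Structural recursions -/

/-- `Σ_t x_t · y_t` (truncating). -/
def dotZ2 : List ℤ → List ℤ → ℤ
  | x :: xs, y :: ys => x * y + dotZ2 xs ys
  | _, _ => 0

/-- `Σ_t x_t · y_t · v_t` (truncating). -/
def dotZ3 : List ℤ → List ℤ → List ℤ → ℤ
  | x :: xs, y :: ys, v :: vs => x * y * v + dotZ3 xs ys vs
  | _, _, _ => 0

/-- `Σ_t v_t · |x_t|` with natural weights (truncating). -/
def absDotN : List ℕ → List ℤ → ℕ
  | v :: vs, x :: xs => v * x.natAbs + absDotN vs xs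
  | _, _ => 0

/-- `Σ_t x_t`. -/
def sumZ : List ℤ → ℤ
  | [] => 0
  | x :: xs => x + sumZ xs

/-- `Σ_t v_t` over naturals. -/
def sumN : List ℕ → ℕ
  | [] => 0
  | v :: vs => v + sumN vs

/-- `max_t |x_t|` (as a natural; `0` for the empty list). -/
def maxAbsZ : List ℤ → ℕ
  | [] => 0
  | x :: xs => max x.natAbs (maxAbsZ xs)

/-- `max` of `maxAbsZ` over the rows of a table. -/
def maxAbsZZ : List (List ℤ) → ℕ
  | [] => 0
  | r :: rs => max (maxAbsZ r) (maxAbsZZ rs)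

/-! ## Readings as `Finset.range` sums -/

/-- `dotZ2` as a sum. -/
theorem dotZ2_eq_sum : ∀ (x y : List ℤ) (k : ℕ), x.length = k → y.length = k →
    (dotZ2 x y : ℝ) = ∑ t ∈ range k, (x.getD t 0 : ℝ) * (y.getD t 0 : ℝ)
  | [], _, k, hx, _ => by subst hx; simp [dotZ2]
  | _ :: _, [], k, hx, hy => by simp at hx hy; omega
  | x :: xs, y :: ys, k, hx, hy => by
      obtain ⟨k, rfl⟩ : ∃ k', k = k' + 1 := ⟨k - 1, by simp at hx; omega⟩
      rw [dotZ2, Finset.sum_range_succ']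
      simp only [List.getD_cons_succ, List.getD_cons_zero]
      push_cast
      rw [dotZ2_eq_sum xs ys k (by simpa using hx) (by simpa using hy)]; ring

/-- `dotZ3` as a sum. -/
theorem dotZ3_eq_sum : ∀ (x y v : List ℤ) (k : ℕ), x.length = k → y.length = k → v.length = k →
    (dotZ3 x y v : ℝ) = ∑ t ∈ range k, (x.getD t 0 : ℝ) * (y.getD t 0 : ℝ) * (v.getD t 0 : ℝ)
  | [], _, _, k, hx, _, _ => by subst hx; simp [dotZ3]
  | _ :: _, [], _, k, hx, hy, _ => by simp at hx hy; omega
  | _ :: _, _ :: _, [], k, hx, _, hv => by simp at hx hv; omega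
  | x :: xs, y :: ys, v :: vs, k, hx, hy, hv => by
      obtain ⟨k, rfl⟩ : ∃ k', k = k' + 1 := ⟨k - 1, by simp at hx; omega⟩
      rw [dotZ3, Finset.sum_range_succ']
      simp only [List.getD_cons_succ, List.getD_cons_zero]
      push_cast
      rw [dotZ3_eq_sum xs ys vs k (by simpa using hx) (by simpa using hy) (by simpa using hv)]; ring

/-- `absDotN` as a sum. -/
theorem absDotN_eq_sum : ∀ (v : List ℕ) (x : List ℤ) (k : ℕ), v.length = k → x.length = k →
    (absDotN v x : ℝ) = ∑ t ∈ range k, (v.getD t 0 : ℝ) * |(x.getD t 0 : ℝ)|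
  | [], _, k, hv, _ => by subst hv; simp [absDotN]
  | _ :: _, [], k, hv, hx => by simp at hx hv; omega
  | v :: vs, x :: xs, k, hv, hx => by
      obtain ⟨k, rfl⟩ : ∃ k', k = k' + 1 := ⟨k - 1, by simp at hv; omega⟩
      rw [absDotN, Finset.sum_range_succ']
      simp only [List.getD_cons_succ, List.getD_cons_zero]
      push_cast
      rw [absDotN_eq_sum vs xs k (by simpa using hv) (by simpa using hx)]
      simp only [Nat.cast_natAbs, Int.cast_abs]; ring

/-- `sumZ` as a sum. -/
theorem sumZ_eq_sum : ∀ (x : List ℤ) (k : ℕ), x.length = k → (sumZ x : ℝ) = ∑ t ∈ range k, (x.getD t 0 : ℝ)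
  | [], k, hx => by subst hx; simp [sumZ]
  | x :: xs, k, hx => by
      obtain ⟨k, rfl⟩ : ∃ k', k = k' + 1 := ⟨k - 1, by simp at hx; omega⟩
      rw [sumZ, Finset.sum_range_succ']
      simp only [List.getD_cons_succ, List.getD_cons_zero]
      push_cast
      rw [sumZ_eq_sum xs k (by simpa using hx)]; ring

/-- `sumN` as a sum. -/
theorem sumN_eq_sum : ∀ (v : List ℕ) (k : ℕ), v.length = k → (sumN v : ℝ) = ∑ t ∈ range k, (v.getD t 0 : ℝ)
  | [], k, hv => by subst hv; simp [sumN]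
  | v :: vs, k, hv => by
      obtain ⟨k, rfl⟩ : ∃ k', k = k' + 1 := ⟨k - 1, by simp at hv; omega⟩
      rw [sumN, Finset.sum_range_succ']
      simp only [List.getD_cons_succ, List.getD_cons_zero]
      push_cast
      rw [sumN_eq_sum vs k (by simpa using hv)]; ring

/-- Every entry is bounded by `maxAbsZ`. -/
theorem abs_le_maxAbsZ : ∀ (x : List ℤ) (t : ℕ), |(x.getD t 0 : ℝ)| ≤ (maxAbsZ x : ℝ)
  | [], t => by simp [maxAbsZ]
  | x :: xs, 0 => by
      rw [List.getD_cons_zero, maxAbsZ, Nat.cast_max, Nat.cast_natAbs, Int.cast_abs]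
      exact le_max_left _ _
  | x :: xs, t + 1 => by
      rw [List.getD_cons_succ, maxAbsZ, Nat.cast_max]
      exact (abs_le_maxAbsZ xs t).trans (le_max_right _ _)

/-- Every entry of a table is bounded by `maxAbsZZ`. -/
theorem abs_le_maxAbsZZ : ∀ (Z : List (List ℤ)) (i t : ℕ),
    |(PsdDyadic.getMZ Z i t : ℝ)| ≤ (maxAbsZZ Z : ℝ)
  | [], i, t => by simp [maxAbsZZ, PsdDyadic.getMZ]
  | r :: rs, 0, t => by
      rw [PsdDyadic.getMZ, List.getD_cons_zero, maxAbsZZ, Nat.cast_max]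
      exact (abs_le_maxAbsZ r t).trans (le_max_left _ _)
  | r :: rs, i + 1, t => by
      have h := abs_le_maxAbsZZ rs i t
      rw [PsdDyadic.getMZ, List.getD_cons_succ]
      rw [PsdDyadic.getMZ] at h
      rw [maxAbsZZ, Nat.cast_max]
      exact h.trans (le_max_right _ _)

/-! ## Perturbation lemmas -/

/-- **One product**: `|x y − x̄ ȳ| ≤ |x̄| η_y + |ȳ| η_x + η_x η_y`. -/
theorem abs_mul_sub_mul_le {x y xb yb ηx ηy : ℝ} (hx : |x - xb| ≤ ηx) (hy : |y - yb| ≤ ηy) :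
    |x * y - xb * yb| ≤ |xb| * ηy + |yb| * ηx + ηx * ηy := by
  have e : x * y - xb * yb = xb * (y - yb) + yb * (x - xb) + (x - xb) * (y - yb) := by ring
  rw [e]
  have h0x : 0 ≤ ηx := (abs_nonneg _).trans hx
  calc |xb * (y - yb) + yb * (x - xb) + (x - xb) * (y - yb)|
      ≤ |xb * (y - yb)| + |yb * (x - xb)| + |(x - xb) * (y - yb)| := abs_add_three _ _ _
    _ = |xb| * |y - yb| + |yb| * |x - xb| + |x - xb| * |y - yb| := by rw [abs_mul, abs_mul, abs_mul]
    _ ≤ |xb| * ηy + |yb| * ηx + ηx * ηy := by gcongr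

/-- **Linear combination with exact coefficients**: `|Σ a_t x_t − Σ a_t x̄_t| ≤ η · Σ |a_t|`. -/
theorem abs_sum_mul_sub_le_lin {k : ℕ} {a x xb : ℕ → ℝ} {η : ℝ} (hx : ∀ t < k, |x t - xb t| ≤ η) :
    |∑ t ∈ range k, a t * x t - ∑ t ∈ range k, a t * xb t| ≤ η * ∑ t ∈ range k, |a t| := by
  rw [← Finset.sum_sub_distrib, Finset.mul_sum]
  refine (Finset.abs_sum_le_sum_abs _ _).trans (Finset.sum_le_sum fun t ht ↦ ?_)
  rw [← mul_sub, abs_mul, mul_comm]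
  exact mul_le_mul_of_nonneg_right (hx t (Finset.mem_range.1 ht)) (abs_nonneg _)

/-- **Weighted products with exact nonnegative weights**:
`|Σ v_t x_t y_t − Σ v_t x̄_t ȳ_t| ≤ η_y Σ v_t|x̄_t| + η_x Σ v_t|ȳ_t| + η_x η_y Σ v_t`. -/
theorem abs_sum_mul3_sub_le {k : ℕ} {v x y xb yb : ℕ → ℝ} {ηx ηy : ℝ} (hv : ∀ t < k, 0 ≤ v t)
    (hx : ∀ t < k, |x t - xb t| ≤ ηx) (hy : ∀ t < k, |y t - yb t| ≤ ηy) :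
    |∑ t ∈ range k, x t * y t * v t - ∑ t ∈ range k, xb t * yb t * v t|
      ≤ ηy * ∑ t ∈ range k, v t * |xb t| + ηx * ∑ t ∈ range k, v t * |yb t|
        + ηx * ηy * ∑ t ∈ range k, v t := by
  rw [← Finset.sum_sub_distrib, Finset.mul_sum, Finset.mul_sum, Finset.mul_sum, ← Finset.sum_add_distrib,
    ← Finset.sum_add_distrib]
  refine (Finset.abs_sum_le_sum_abs _ _).trans (Finset.sum_le_sum fun t ht ↦ ?_)
  have htk := Finset.mem_range.1 ht
  have h := abs_mul_sub_mul_le (hx t htk) (hy t htk)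
  rw [← sub_mul, abs_mul, abs_of_nonneg (hv t htk)]
  calc |x t * y t - xb t * yb t| * v t ≤ (|xb t| * ηy + |yb t| * ηx + ηx * ηy) * v t :=
        mul_le_mul_of_nonneg_right h (hv t htk)
    _ = ηy * (v t * |xb t|) + ηx * (v t * |yb t|) + ηx * ηy * v t := by ring

/-- **Plain products**: `|Σ x_t y_t − Σ x̄_t ȳ_t| ≤ η_y Σ |x̄_t| + η_x Σ |ȳ_t| + k η_x η_y`. -/
theorem abs_sum_mul_sub_le {k : ℕ} {x y xb yb : ℕ → ℝ} {ηx ηy : ℝ}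
    (hx : ∀ t < k, |x t - xb t| ≤ ηx) (hy : ∀ t < k, |y t - yb t| ≤ ηy) :
    |∑ t ∈ range k, x t * y t - ∑ t ∈ range k, xb t * yb t|
      ≤ ηy * ∑ t ∈ range k, |xb t| + ηx * ∑ t ∈ range k, |yb t| + ηx * ηy * k := by
  have h := abs_sum_mul3_sub_le (v := fun _ ↦ (1 : ℝ)) (fun _ _ ↦ zero_le_one) hx hy
  simpa using h

/-- **Exact weights against ONE perturbed factor**: `|Σ a_t x_t y − Σ a_t x̄_t ȳ|`-type bounds reduce to the linear lemma;
this is the mixed form `|Σ x_t y_t − Σ x̄_t ȳ_t|` when `y` is exact (`η_y = 0`). -/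
theorem abs_sum_mul_sub_le_exact_right {k : ℕ} {x xb y : ℕ → ℝ} {ηx : ℝ} (hx : ∀ t < k, |x t - xb t| ≤ ηx) :
    |∑ t ∈ range k, x t * y t - ∑ t ∈ range k, xb t * y t| ≤ ηx * ∑ t ∈ range k, |y t| := by
  have h := abs_sum_mul_sub_le_lin (a := y) (x := x) (xb := xb) hx
  have e1 : ∑ t ∈ range k, x t * y t = ∑ t ∈ range k, y t * x t := Finset.sum_congr rfl fun _ _ ↦ mul_comm _ _
  have e2 : ∑ t ∈ range k, xb t * y t = ∑ t ∈ range k, y t * xb t := Finset.sum_congr rfl fun _ _ ↦ mul_comm _ _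
  rw [e1, e2]; exact h

/-- Triangle step used at every stage: `|x − c| ≤ |x − x̄| + |x̄ − c|`. -/
theorem abs_sub_le_of_mid {x xb c η ζ : ℝ} (h1 : |x - xb| ≤ η) (h2 : |xb - c| ≤ ζ) : |x - c| ≤ η + ζ :=
  (abs_sub_le x xb c).trans (add_le_add h1 h2)

/-! ## Claimed integer tables EQUAL to computed rows (band glue) -/

/-- `∀ p, p₀ ≤ p < p₀ + k → P p` as one Boolean (structural in `k`). -/
def allFromTo (p₀ : ℕ) : ℕ → (ℕ → Bool) → Bool
  | 0, _ => true
  | k + 1, P => P p₀ && allFromTo (p₀ + 1) k P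

/-- **Specification of `allFromTo`.** -/
theorem allFromTo_spec {p₀ k : ℕ} {P : ℕ → Bool} (h : allFromTo p₀ k P = true) :
    ∀ p, p₀ ≤ p → p < p₀ + k → P p = true := by
  induction k generalizing p₀ with
  | zero => intro p h1 h2; omega
  | succ k ih =>
      simp only [allFromTo, Bool.and_eq_true] at h
      intro p h1 h2
      by_cases hp : p = p₀
      · subst hp; exact h.1
      · exact ih h.2 p (by omega) (by omega)

/-- `RowsEq F C n`: for every `p < n`, the claimed row `C[p]` IS the computed row `F p`. -/
structure RowsEq (F : ℕ → List ℤ) (C : List (List ℤ)) (n : ℕ) : Prop where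
  /-- claimed row `p` equals the computed row -/
  out : ∀ p < n, C.getD p [] = F p

/-- Band glue: no rows yet. -/
theorem RowsEq.zero {F : ℕ → List ℤ} {C : List (List ℤ)} : RowsEq F C 0 :=
  ⟨fun _ hp ↦ absurd hp (by omega)⟩

/-- The band check: rows `[p₀, p₀ + k)` of the claim equal the computed rows. -/
def checkRowsEq (F : ℕ → List ℤ) (C : List (List ℤ)) (p₀ k : ℕ) : Bool :=
  allFromTo p₀ k fun p ↦ decide (C.getD p [] = F p)

/-- **Band glue**: rows below `n` extend to rows below `n + k` by one passing band check. -/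
theorem RowsEq.extend {F : ℕ → List ℤ} {C : List (List ℤ)} {n k : ℕ} (h1 : RowsEq F C n)
    (h2 : checkRowsEq F C n k = true) : RowsEq F C (n + k) := by
  refine ⟨fun p hp ↦ ?_⟩
  by_cases hpn : p < n
  · exact h1.out p hpn
  · have := allFromTo_spec h2 p (by omega) hp
    rwa [decide_eq_true_eq] at this

/-- Reading one entry of a `RowsEq` family through `getMZ`. -/
theorem RowsEq.getMZ_eq {F : ℕ → List ℤ} {C : List (List ℤ)} {n : ℕ} (h : RowsEq F C n) {p : ℕ} (hp : p < n)
    (t : ℕ) : PsdDyadic.getMZ C p t = (F p).getD t 0 := by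
  rw [PsdDyadic.getMZ, h.out p hp]

/-! ## Claimed primitive tables (the uniform input-fact shape of the composite) -/

/-- **Claimed two-index table**: `|f i j − Z[i][j]/2^c| ≤ ρ/2^c` for `i < n`, `j < k` (entries beyond the table read `0`). -/
structure TabNear (f : ℕ → ℕ → ℝ) (n k c ρ : ℕ) (Z : List (List ℤ)) : Prop where
  /-- the entrywise enclosure -/
  out : ∀ i < n, ∀ j < k, |f i j - (PsdDyadic.getMZ Z i j : ℝ) / 2 ^ c| ≤ (ρ : ℝ) / 2 ^ c

/-- **Claimed one-index table**: `|f i − Z[i]/2^c| ≤ ρ/2^c` for `i < n`. -/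
structure VecNear (f : ℕ → ℝ) (n c ρ : ℕ) (Z : List ℤ) : Prop where
  /-- the entrywise enclosure -/
  out : ∀ i < n, |f i - (Z.getD i 0 : ℝ) / 2 ^ c| ≤ (ρ : ℝ) / 2 ^ c

/-- A two-index table fact restricted to one row is a one-index fact. -/
theorem TabNear.row {f : ℕ → ℕ → ℝ} {n k c ρ : ℕ} {Z : List (List ℤ)} (h : TabNear f n k c ρ Z)
    {i : ℕ} (hi : i < n) : VecNear (f i) k c ρ (Z.getD i []) :=
  ⟨fun j hj ↦ by simpa [PsdDyadic.getMZ] using h.out i hi j hj⟩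

/-- Weakening the radius of a table fact. -/
theorem TabNear.mono {f : ℕ → ℕ → ℝ} {n k c ρ ρ' : ℕ} {Z : List (List ℤ)} (h : TabNear f n k c ρ Z) (hρ : ρ ≤ ρ') :
    TabNear f n k c ρ' Z :=
  ⟨fun i hi j hj ↦ (h.out i hi j hj).trans (by gcongr)⟩

/-- An EXACT table (radius `0`): `f i j = Z[i][j]/2^c`. -/
theorem TabNear.of_eq {f : ℕ → ℕ → ℝ} {n k c : ℕ} {Z : List (List ℤ)}
    (h : ∀ i < n, ∀ j < k, f i j = (PsdDyadic.getMZ Z i j : ℝ) / 2 ^ c) : TabNear f n k c 0 Z :=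
  ⟨fun i hi j hj ↦ by rw [h i hi j hj, sub_self, abs_zero]; positivity⟩

/-- An EXACT one-index table. -/
theorem VecNear.of_eq {f : ℕ → ℝ} {n c : ℕ} {Z : List ℤ} (h : ∀ i < n, f i = (Z.getD i 0 : ℝ) / 2 ^ c) :
    VecNear f n c 0 Z :=
  ⟨fun i hi ↦ by rw [h i hi, sub_self, abs_zero]; positivity⟩

/-- Reading a table fact as «midpoint + radius» data for the perturbation lemmas (row form). -/
theorem TabNear.abs_sub_le {f : ℕ → ℕ → ℝ} {n k c ρ : ℕ} {Z : List (List ℤ)} (h : TabNear f n k c ρ Z)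
    {i : ℕ} (hi : i < n) : ∀ j < k, |f i j - (PsdDyadic.getMZ Z i j : ℝ) / 2 ^ c| ≤ (ρ : ℝ) / 2 ^ c :=
  fun j hj ↦ h.out i hi j hj

/-! ## The final u-grid check in exact integers -/

/-- The per-entry final check: `|S̄ − mid·2^(E−cu)| + ηZ ≤ ρZ·2^(E−cu)` (all integers; `S̄` at scale `2^E`, the claimed
midpoint `mid` at the unit `u = 1/2^cu`, `ηZ/2^E` an upper bound of the accumulated error). -/
def checkEntryU (E cu : ℕ) (ρZ : ℤ) (Sbar ηZ mid : ℤ) : Bool :=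
  decide (|Sbar - mid * 2 ^ (E - cu)| + ηZ ≤ ρZ * 2 ^ (E - cu))

/-- **Soundness of the final check**: the door's `|S − mid·u| ≤ ρZ·u`, `u = 1/2^cu`. -/
theorem nearU_of_checkEntryU {E cu : ℕ} (hcu : cu ≤ E) {ρZ Sbar ηZ mid : ℤ} {S : ℝ}
    (hS : |S - (Sbar : ℝ) / 2 ^ E| ≤ (ηZ : ℝ) / 2 ^ E) (h : checkEntryU E cu ρZ Sbar ηZ mid = true) :
    |S - (mid : ℝ) * (1 / 2 ^ cu)| ≤ (ρZ : ℝ) * (1 / 2 ^ cu) := by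
  unfold checkEntryU at h
  rw [decide_eq_true_eq] at h
  have h' : (|Sbar - mid * 2 ^ (E - cu)| : ℝ) + ηZ ≤ ρZ * 2 ^ (E - cu) := by exact_mod_cast h
  have h2E : (0 : ℝ) < 2 ^ E := by positivity
  have hpow : (2 : ℝ) ^ E = 2 ^ (E - cu) * 2 ^ cu := by rw [← pow_add, Nat.sub_add_cancel hcu]
  -- `|S̄/2^E − mid/2^cu| = |S̄ − mid 2^(E−cu)| / 2^E`
  have e1 : (Sbar : ℝ) / 2 ^ E - (mid : ℝ) * (1 / 2 ^ cu) = ((Sbar : ℝ) - mid * 2 ^ (E - cu)) / 2 ^ E := by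
    rw [hpow]; field_simp
  have hmid : |(Sbar : ℝ) / 2 ^ E - (mid : ℝ) * (1 / 2 ^ cu)| ≤ ((ρZ : ℝ) * 2 ^ (E - cu) - ηZ) / 2 ^ E := by
    rw [e1, abs_div, abs_of_pos h2E, div_le_div_iff_of_pos_right h2E]
    linarith
  have e2 : (ρZ : ℝ) * (1 / 2 ^ cu) = (ρZ : ℝ) * 2 ^ (E - cu) / 2 ^ E := by
    rw [hpow]; field_simp
  calc |S - (mid : ℝ) * (1 / 2 ^ cu)|
      ≤ |S - (Sbar : ℝ) / 2 ^ E| + |(Sbar : ℝ) / 2 ^ E - (mid : ℝ) * (1 / 2 ^ cu)| := abs_sub_le _ _ _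
    _ ≤ (ηZ : ℝ) / 2 ^ E + ((ρZ : ℝ) * 2 ^ (E - cu) - ηZ) / 2 ^ E := add_le_add hS hmid
    _ = (ρZ : ℝ) * (1 / 2 ^ cu) := by rw [e2]; field_simp; ring

end CinfExact

end Summit.RiemannHypothesis.RiemannHypothesis.Theorems.WeilFormatC
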